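import Summits.BirchSwinnertonDyer.BirchSwinnertonDyer.Theorems.ResidualThetaTransportAtTwoThetaLayerLambdaCongruenceAtTwoHeckeAdjointAnchors
import Summits.BirchSwinnertonDyer.BirchSwinnertonDyer.Theorems.ResidualThetaTransportAtTwoThetaLayerLambdaCongruenceAtTwoHeckeAdjointFlagSide
import Summits.BirchSwinnertonDyer.BirchSwinnertonDyer.Theorems.ResidualThetaTransportAtTwoThetaLayerLambdaCongruenceAtTwoHeckeAdjointSideFormula
import Summits.BirchSwinnertonDyer.BirchSwinnertonDyer.Theorems.ResidualThetaTransportAtTwoThetaLayerLambdaCongruenceAtTwoCrossingPairingHecke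
import HarnessLib

/-!
# Crux `ThetaLayerLambdaCongruenceAtTwo` (stmt-BirchSwinnertonDyer-20688, route ResidualThetaTransportAtTwo), line
# `birth` v14 — SD floor, kernel road, Hecke clause of IP, brick HA6 «DUAL SIDE»: for a pairing `B` with w2's crossing formula and a
# Hecke cocycle `α'_{i'} γ = δ'_{i'} α'_{σ' i'}` acting on the DUAL slot, `2·Σ_{i'} B({∞,δ'_{i'}∞}, {∞,γ'∞})` is the flag sum
# `Σ_{g ∈ L(γ')} Σ_{i'} Σ'_{u∈Γ₀(N)} [F(g⁻¹u⁻¹α'_{i'}γ) − F(g⁻¹u⁻¹α'_{i'})]`; plus the κ-cancellation identity (width seat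
# bsd-wall-rtt-p3-w3 g11; `--supports stmt-BirchSwinnertonDyer-20688 --as helper`; closes nothing)

HONEST FRAMING. THEOREMS only, about an arbitrary bi-additive `B` satisfying w2's crossing formula (the hypothesis `hB` is the formula of
`exists_perfect_crossingPairing_hecke` verbatim); no definition; nothing about any curve or form is asserted; BSD is not proved by any of this.

WHAT (memo `Cruxes/ThetaLayerLambdaCongruenceAtTwo/Lines/birth-sd2-hecke-adjoint.md`, steps (A)–(C),(E)). (1) `finsum_kappa_cancel`: for ANY
finitely supported `κ : SL₂(ℤ) → ℤ` and `γ ∈ Γ₀(N)`, `Σ'_{u∈Γ₀(N)} (κ(u⁻¹γ) − κ(u⁻¹)) = 0` (re-index `u ↦ γ⁻¹u`). (2) `dual_side_flag_sum`: the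
dual-slot side of the transpose identity — anchors (HA1: `sum_dualChainVec_anchor`), the anchor triangles of the flags `α'_{i'}·φ₀` (HA2:
`exists_flagAnchor`), the side formula (HA3: `two_mul_dualChainVec_eq_finsum`) and the cocycle turn `Σ_{i'} vec(D_{δ'_{i'}})` into the flag sum
displayed above, where `F` is the flag side function of `…HeckeAdjointFlagSide` evaluated on integer matrices.

References: [Merel1995Homologie] §1.2–2.2; [Manin1972] §1.5–1.7; [Shimura1971] §3.1 (coset permutations).
-/

set_option autoImplicit false

noncomputable section

-- justification: the `Summit.BirchSwinnertonDyer.BirchSwinnertonDyer.…` path repeats a component (route-file convention)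
set_option linter.dupNamespace false

open scoped Classical MatrixGroups

open CongruenceSubgroup Matrix.SpecialLinearGroup ModularGroup
open Literature.NumberTheory.EllipticCurves.ModularForms

namespace Summit.BirchSwinnertonDyer.BirchSwinnertonDyer.Theorems.ThetaLayerLambdaCongruenceAtTwo

section Cancel

variable {N : ℕ}

/-- **κ-cancellation (brick HA6).** For a finitely supported `κ : SL₂(ℤ) → ℤ` and `γ ∈ Γ₀(N)`: `Σ'_{u∈Γ₀(N)} (κ(u⁻¹γ) − κ(u⁻¹)) = 0` —
both finsums are finite and `u ↦ γ⁻¹u` is a bijection of `Γ₀(N)` carrying one onto the other. [folklore] -/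
theorem finsum_kappa_cancel (κ : SL(2, ℤ) → ℤ) (hκ : (Function.support κ).Finite) (γ : Gamma0 N) :
    ∑ᶠ u : Gamma0 N, (κ (((u⁻¹ : Gamma0 N) : SL(2, ℤ)) * γ) - κ ((u⁻¹ : Gamma0 N) : SL(2, ℤ))) = 0 := by
  have hf1 : (Function.support fun u : Gamma0 N ↦ κ (((u⁻¹ : Gamma0 N) : SL(2, ℤ)) * γ)).Finite := by
    have hinj : Set.InjOn (fun u : Gamma0 N ↦ ((u⁻¹ : Gamma0 N) : SL(2, ℤ)) * γ)
        ((fun u : Gamma0 N ↦ ((u⁻¹ : Gamma0 N) : SL(2, ℤ)) * γ) ⁻¹' Function.support κ) := by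
      intro a _ b _ h
      have h' : ((a⁻¹ : Gamma0 N) : SL(2, ℤ)) = ((b⁻¹ : Gamma0 N) : SL(2, ℤ)) := mul_right_cancel h
      exact inv_injective (Subtype.coe_injective h')
    exact hκ.preimage hinj
  have hf2 : (Function.support fun u : Gamma0 N ↦ κ ((u⁻¹ : Gamma0 N) : SL(2, ℤ))).Finite := by
    have hinj : Set.InjOn (fun u : Gamma0 N ↦ ((u⁻¹ : Gamma0 N) : SL(2, ℤ)))
        ((fun u : Gamma0 N ↦ ((u⁻¹ : Gamma0 N) : SL(2, ℤ))) ⁻¹' Function.support κ) := by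
      intro a _ b _ h
      exact inv_injective (Subtype.coe_injective h)
    exact hκ.preimage hinj
  rw [finsum_sub_distrib hf1 hf2, sub_eq_zero]
  have key := finsum_comp_equiv (Equiv.mulLeft γ⁻¹) (f := fun u : Gamma0 N ↦ κ ((u⁻¹ : Gamma0 N) : SL(2, ℤ)))
  rw [← key]
  refine finsum_congr fun u ↦ ?_
  simp only [Equiv.coe_mulLeft, mul_inv_rev, inv_inv, Subgroup.coe_mul]

end Cancel

section DualSide

variable {N : ℕ} [NeZero N]

/-- Swapping a finite index sum with a list sum. [folklore] -/
theorem sum_list_map_swap {ι : Type} (s : Finset ι) (L : List SL(2, ℤ)) (f : ι → SL(2, ℤ) → ℤ) :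
    (∑ i ∈ s, (L.map (f i)).sum) = (L.map fun g ↦ ∑ i ∈ s, f i g).sum := by
  induction L with
  | nil => simp
  | cons g L ih => simp [Finset.sum_add_distrib, ih]

/-- **Dual side of the transpose identity (brick HA6).** Let `B` satisfy w2's crossing formula, `L` be a Manin chain of `γ'`, and
`α'_{i'} γ = δ'_{i'} α'_{σ' i'}` a Hecke cocycle (`α'` integer matrices of positive determinant, `σ'` a permutation, `δ' ∈ Γ₀(N)`). Then
`2·Σ_{i'} B({∞, δ'_{i'}∞}, {∞, γ'∞}) = Σ_{g∈L} Σ_{i'} Σ'_{u∈Γ₀(N)} [F(g⁻¹u⁻¹α'_{i'}γ) − F(g⁻¹u⁻¹α'_{i'})]` (`F` the flag side function).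
[cite: Merel1995Homologie, §2.2] [cite: Manin1972, §1.5] -/
theorem dual_side_flag_sum (B : periodHomologyHecke N →+ (periodHomologyHecke N →+ ℤ))
    (hB : ∀ (γ γ' : Gamma0 N) (D L : List SL(2, ℤ)),
      (∀ {A : Type} [AddCommGroup A] (G : SL(2, ℤ) → A), (∀ x, G (x * (S * T⁻¹)) = G x) → (∀ x, G (-x) = G x) →
        (D.map fun h ↦ G h - G (h * S)).sum = G (γ : SL(2, ℤ)) - G 1) →
      (∀ {A : Type} [AddCommGroup A] (F : SL(2, ℤ) → A), (∀ g, F (g * T) = F g) → (∀ g, F (-g) = F g) →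
        (L.map fun g ↦ F g - F (g * S)).sum = F (γ' : SL(2, ℤ)) - F 1) →
      B ⟨periodFunctional N γ, (mem_periodHomologyHecke N).mpr (periodFunctional_mem_periodHomology N γ)⟩
        ⟨periodFunctional N γ', (mem_periodHomologyHecke N).mpr (periodFunctional_mem_periodHomology N γ')⟩ =
        (L.map fun g ↦ (D.map fun h ↦ (Pi.single ((h⁻¹ : SL(2, ℤ)) : Gamma0Coset N) (1 : ℤ) -
          Pi.single (((h * S)⁻¹ : SL(2, ℤ)) : Gamma0Coset N) 1 : Gamma0Coset N → ℤ)).sum ((g⁻¹ : SL(2, ℤ)) : Gamma0Coset N)).sum)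
    (γ γ' : Gamma0 N) (L : List SL(2, ℤ))
    (hL : ∀ {A : Type} [AddCommGroup A] (F : SL(2, ℤ) → A), (∀ g, F (g * T) = F g) → (∀ g, F (-g) = F g) →
      (L.map fun g ↦ F g - F (g * S)).sum = F (γ' : SL(2, ℤ)) - F 1)
    {ι' : Type} [Fintype ι'] (α' : ι' → Matrix (Fin 2) (Fin 2) ℤ) (hdet' : ∀ i', 0 < (α' i').det)
    (δ' : ι' → Gamma0 N) (σ' : Equiv.Perm ι')
    (hcoc' : ∀ i', α' i' * ((γ : SL(2, ℤ)) : Matrix (Fin 2) (Fin 2) ℤ) = (((δ' i' : Gamma0 N) : SL(2, ℤ)) : Matrix (Fin 2) (Fin 2) ℤ) * α' (σ' i')) :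
    2 * ∑ i', B ⟨periodFunctional N (δ' i'), (mem_periodHomologyHecke N).mpr (periodFunctional_mem_periodHomology N (δ' i'))⟩
        ⟨periodFunctional N γ', (mem_periodHomologyHecke N).mpr (periodFunctional_mem_periodHomology N γ')⟩ =
      (L.map fun g ↦ ∑ i', ∑ᶠ u : Gamma0 N,
        ((if (0 < (((g⁻¹ : SL(2, ℤ)) : Matrix (Fin 2) (Fin 2) ℤ) * ((u⁻¹ : Gamma0 N) : SL(2, ℤ)) * α' i' * ((γ : SL(2, ℤ)) : Matrix (Fin 2) (Fin 2) ℤ)) 0 0 * (((g⁻¹ : SL(2, ℤ)) : Matrix (Fin 2) (Fin 2) ℤ) * ((u⁻¹ : Gamma0 N) : SL(2, ℤ)) * α' i' * ((γ : SL(2, ℤ)) : Matrix (Fin 2) (Fin 2) ℤ)) 1 0 ∨ ((((g⁻¹ : SL(2, ℤ)) : Matrix (Fin 2) (Fin 2) ℤ) * ((u⁻¹ : Gamma0 N) : SL(2, ℤ)) * α' i' * ((γ : SL(2, ℤ)) : Matrix (Fin 2) (Fin 2) ℤ)) 0 0 * (((g⁻¹ : SL(2, ℤ)) : Matrix (Fin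 2) (Fin 2) ℤ) * ((u⁻¹ : Gamma0 N) : SL(2, ℤ)) * α' i' * ((γ : SL(2, ℤ)) : Matrix (Fin 2) (Fin 2) ℤ)) 1 0 = 0 ∧ (0 < ((((g⁻¹ : SL(2, ℤ)) : Matrix (Fin 2) (Fin 2) ℤ) * ((u⁻¹ : Gamma0 N) : SL(2, ℤ)) * α' i' * ((γ : SL(2, ℤ)) : Matrix (Fin 2) (Fin 2) ℤ)) 0 0 + 2 * (((g⁻¹ : SL(2, ℤ)) : Matrix (Fin 2) (Fin 2) ℤ) * ((u⁻¹ : Gamma0 N) : SL(2, ℤ)) * α' i' * ((γ : SL(2, ℤ)) : Matrix (Fin 2) (Fin 2) ℤ)) 0 1) * ((((g⁻¹ : SL(2, ℤ)) : Matrix (Fin 2) (Fin 2) ℤ) * ((u⁻¹ : Gamma0 N) : SL(2, ℤ)) * α' i' * ((γ : SL(2, ℤ)) : Matrix (Fin 2) (Fin 2) ℤ)) 1 0 + 2 * (((g⁻¹ : SL(2, ℤ)) : Matrix (Fin 2) (Fin 2) ℤ) * ((u⁻¹ : Gamma0 N) : SL(2, ℤ)) * α' i' * ((γ : SL(2, ℤ))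 : Matrix (Fin 2) (Fin 2) ℤ)) 1 1) ∨
          (((((g⁻¹ : SL(2, ℤ)) : Matrix (Fin 2) (Fin 2) ℤ) * ((u⁻¹ : Gamma0 N) : SL(2, ℤ)) * α' i' * ((γ : SL(2, ℤ)) : Matrix (Fin 2) (Fin 2) ℤ)) 0 0 + 2 * (((g⁻¹ : SL(2, ℤ)) : Matrix (Fin 2) (Fin 2) ℤ) * ((u⁻¹ : Gamma0 N) : SL(2, ℤ)) * α' i' * ((γ : SL(2, ℤ)) : Matrix (Fin 2) (Fin 2) ℤ)) 0 1) * ((((g⁻¹ : SL(2, ℤ)) : Matrix (Fin 2) (Fin 2) ℤ) * ((u⁻¹ : Gamma0 N) : SL(2, ℤ)) * α' i' * ((γ : SL(2, ℤ)) : Matrix (Fin 2) (Fin 2) ℤ)) 1 0 + 2 * (((g⁻¹ : SL(2, ℤ)) : Matrix (Fin 2) (Fin 2) ℤ) * ((u⁻¹ : Gamma0 N) : SL(2, ℤ)) * α' i' * ((γ : SL(2, ℤ)) : Matrix (Fin 2) (Fin 2) ℤ)) 1 1) = 0 ∧ 0 < (((g⁻¹ : SL(2, ℤ)) : Matrix (Fin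 2) (Fin 2) ℤ) * ((u⁻¹ : Gamma0 N) : SL(2, ℤ)) * α' i' * ((γ : SL(2, ℤ)) : Matrix (Fin 2) (Fin 2) ℤ)) 0 0 * (((g⁻¹ : SL(2, ℤ)) : Matrix (Fin 2) (Fin 2) ℤ) * ((u⁻¹ : Gamma0 N) : SL(2, ℤ)) * α' i' * ((γ : SL(2, ℤ)) : Matrix (Fin 2) (Fin 2) ℤ)) 1 1 + (((g⁻¹ : SL(2, ℤ)) : Matrix (Fin 2) (Fin 2) ℤ) * ((u⁻¹ : Gamma0 N) : SL(2, ℤ)) * α' i' * ((γ : SL(2, ℤ)) : Matrix (Fin 2) (Fin 2) ℤ)) 0 1 * (((g⁻¹ : SL(2, ℤ)) : Matrix (Fin 2) (Fin 2) ℤ) * ((u⁻¹ : Gamma0 N) : SL(2, ℤ)) * α' i' * ((γ : SL(2, ℤ)) : Matrix (Fin 2) (Fin 2) ℤ)) 1 0)))) then (1 : ℤ) else 0) -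
         (if (0 < (((g⁻¹ : SL(2, ℤ)) : Matrix (Fin 2) (Fin 2) ℤ) * ((u⁻¹ : Gamma0 N) : SL(2, ℤ)) * α' i') 0 0 * (((g⁻¹ : SL(2, ℤ)) : Matrix (Fin 2) (Fin 2) ℤ) * ((u⁻¹ : Gamma0 N) : SL(2, ℤ)) * α' i') 1 0 ∨ ((((g⁻¹ : SL(2, ℤ)) : Matrix (Fin 2) (Fin 2) ℤ) * ((u⁻¹ : Gamma0 N) : SL(2, ℤ)) * α' i') 0 0 * (((g⁻¹ : SL(2, ℤ)) : Matrix (Fin 2) (Fin 2) ℤ) * ((u⁻¹ : Gamma0 N) : SL(2, ℤ)) * α' i') 1 0 = 0 ∧ (0 < ((((g⁻¹ : SL(2, ℤ)) : Matrix (Fin 2) (Fin 2) ℤ) * ((u⁻¹ : Gamma0 N) : SL(2, ℤ)) * α' i') 0 0 + 2 * (((g⁻¹ : SL(2, ℤ)) : Matrix (Fin 2) (Fin 2) ℤ) * ((u⁻¹ : Gamma0 N) : SL(2, ℤ)) * α' i') 0 1) * ((((g⁻¹ : SL(2, ℤ)) : Matrix (Fin 2) (Fin 2) ℤ) * ((u⁻¹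 : Gamma0 N) : SL(2, ℤ)) * α' i') 1 0 + 2 * (((g⁻¹ : SL(2, ℤ)) : Matrix (Fin 2) (Fin 2) ℤ) * ((u⁻¹ : Gamma0 N) : SL(2, ℤ)) * α' i') 1 1) ∨
          (((((g⁻¹ : SL(2, ℤ)) : Matrix (Fin 2) (Fin 2) ℤ) * ((u⁻¹ : Gamma0 N) : SL(2, ℤ)) * α' i') 0 0 + 2 * (((g⁻¹ : SL(2, ℤ)) : Matrix (Fin 2) (Fin 2) ℤ) * ((u⁻¹ : Gamma0 N) : SL(2, ℤ)) * α' i') 0 1) * ((((g⁻¹ : SL(2, ℤ)) : Matrix (Fin 2) (Fin 2) ℤ) * ((u⁻¹ : Gamma0 N) : SL(2, ℤ)) * α' i') 1 0 + 2 * (((g⁻¹ : SL(2, ℤ)) : Matrix (Fin 2) (Fin 2) ℤ) * ((u⁻¹ : Gamma0 N) : SL(2, ℤ)) * α' i') 1 1) = 0 ∧ 0 < (((g⁻¹ : SL(2, ℤ)) : Matrix (Fin 2) (Fin 2) ℤ) * ((u⁻¹ : Gamma0 N) : SL(2, ℤ)) * α' i') 0 0 * (((g⁻¹ : SL(2, ℤ))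 : Matrix (Fin 2) (Fin 2) ℤ) * ((u⁻¹ : Gamma0 N) : SL(2, ℤ)) * α' i') 1 1 + (((g⁻¹ : SL(2, ℤ)) : Matrix (Fin 2) (Fin 2) ℤ) * ((u⁻¹ : Gamma0 N) : SL(2, ℤ)) * α' i') 0 1 * (((g⁻¹ : SL(2, ℤ)) : Matrix (Fin 2) (Fin 2) ℤ) * ((u⁻¹ : Gamma0 N) : SL(2, ℤ)) * α' i') 1 0)))) then (1 : ℤ) else 0))).sum := by
  -- dual chains of the cocycle and anchors of the flags `α'_{i'} φ₀`
  choose D hD using fun i' ↦ exists_dualChain (((δ' i' : Gamma0 N) : SL(2, ℤ)))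
  choose m hm using fun i' ↦ exists_flagAnchor (α' i') (hdet' i')
  choose Am hAm using fun i' ↦ exists_dualChain (m i')
  -- translated walks from `m i'` to `δ' i' · m (σ' i')`
  let E : ι' → List SL(2, ℤ) := fun i' ↦
    ((Am i').map fun h ↦ h * S) ++ D i' ++ (Am (σ' i')).map fun h ↦ ((δ' i' : Gamma0 N) : SL(2, ℤ)) * h
  have hE : ∀ i', ∀ {A : Type} [AddCommGroup A] (G : SL(2, ℤ) → A), (∀ x, G (x * (S * T⁻¹)) = G x) → (∀ x, G (-x) = G x) →
      ((E i').map fun h ↦ G h - G (h * S)).sum = G (((δ' i' : Gamma0 N) : SL(2, ℤ)) * m (σ' i')) - G (m i') :=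
    fun i' _ _ G hτ hn ↦ dualChain_between_of_pieces (m i') (m (σ' i')) _ (Am i') (Am (σ' i')) (D i') (hAm i') (hAm (σ' i')) (hD i') G hτ hn
  -- expand `B` through the crossing formula, swap the sums, apply the anchors identity and the side formula
  have hBi : ∀ i', B ⟨periodFunctional N (δ' i'), (mem_periodHomologyHecke N).mpr (periodFunctional_mem_periodHomology N (δ' i'))⟩
      ⟨periodFunctional N γ', (mem_periodHomologyHecke N).mpr (periodFunctional_mem_periodHomology N γ')⟩ =
      (L.map fun g ↦ ((D i').map fun h ↦ (Pi.single ((h⁻¹ : SL(2, ℤ)) : Gamma0Coset N) (1 : ℤ) -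
          Pi.single (((h * S)⁻¹ : SL(2, ℤ)) : Gamma0Coset N) 1 : Gamma0Coset N → ℤ)).sum ((g⁻¹ : SL(2, ℤ)) : Gamma0Coset N)).sum :=
    fun i' ↦ hB (δ' i') γ' (D i') L (hD i') hL
  simp_rw [hBi]
  rw [sum_list_map_swap, ← List.sum_map_mul_left]
  congr 1
  refine List.map_congr_left fun g _ ↦ ?_
  rw [← sum_dualChainVec_anchor σ' δ' m D E hD hE ((g⁻¹ : SL(2, ℤ)) : Gamma0Coset N), Finset.mul_sum]
  refine Finset.sum_congr rfl fun i' _ ↦ ?_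
  rw [two_mul_dualChainVec_eq_finsum (m i') (((δ' i' : Gamma0 N) : SL(2, ℤ)) * m (σ' i')) (E i') (hE i') g]
  refine finsum_congr fun u ↦ ?_
  -- anchors: `G₁((ug)⁻¹ m) = F((ug)⁻¹ α')`, and the cocycle
  have h1 := hm i' ((u : SL(2, ℤ)) * g)
  have h2 := hm (σ' i') ((((δ' i' : Gamma0 N) : SL(2, ℤ)))⁻¹ * (u : SL(2, ℤ)) * g)
  have e1 : ((((u : SL(2, ℤ)) * g)⁻¹ : SL(2, ℤ)) : Matrix (Fin 2) (Fin 2) ℤ) * α' i' =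
      ((g⁻¹ : SL(2, ℤ)) : Matrix (Fin 2) (Fin 2) ℤ) * ((u⁻¹ : Gamma0 N) : SL(2, ℤ)) * α' i' := by
    rw [mul_inv_rev, Matrix.SpecialLinearGroup.coe_mul]; rfl
  have e2 : (((((δ' i' : Gamma0 N) : SL(2, ℤ))⁻¹ * (u : SL(2, ℤ)) * g)⁻¹ : SL(2, ℤ)) : Matrix (Fin 2) (Fin 2) ℤ) * α' (σ' i') =
      ((g⁻¹ : SL(2, ℤ)) : Matrix (Fin 2) (Fin 2) ℤ) * ((u⁻¹ : Gamma0 N) : SL(2, ℤ)) * α' i' * ((γ : SL(2, ℤ)) : Matrix (Fin 2) (Fin 2) ℤ) := by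
    rw [mul_inv_rev, mul_inv_rev, inv_inv, Matrix.SpecialLinearGroup.coe_mul, Matrix.SpecialLinearGroup.coe_mul, Matrix.mul_assoc,
      Matrix.mul_assoc, ← hcoc', ← Matrix.mul_assoc, ← Matrix.mul_assoc]
    rfl
  have e3 : (((δ' i' : Gamma0 N) : SL(2, ℤ))⁻¹ * (u : SL(2, ℤ)) * g)⁻¹ * m (σ' i') =
      ((u : SL(2, ℤ)) * g)⁻¹ * (((δ' i' : Gamma0 N) : SL(2, ℤ)) * m (σ' i')) := by
    simp only [mul_inv_rev, inv_inv, mul_assoc]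
  rw [e1] at h1
  rw [e2, e3] at h2
  rw [← h1, ← h2]

end DualSide

end Summit.BirchSwinnertonDyer.BirchSwinnertonDyer.Theorems.ThetaLayerLambdaCongruenceAtTwo

end
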